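import Mathlib

/-!
# Crux `RefutationDegree.BeyondHessianSos` (stmt-ValiantsHypothesis-5643), line `Sketch` —
# stub `stub_cubicNullBound`

A linear subspace `A ⊆ ℂ^ι` on which the power sums `p₂(x) = ∑ xᵢ²` and `p₃(x) = ∑ xᵢ³` vanish
identically satisfies `9 · dim A ≤ 4 · |ι|`, *assuming* Kneser's theorem for coordinatewise
products of subspaces (Mirandola–Zémor), which is taken as the hypothesis `hK`.

Proof outline.
* Polarisation: `∑ xᵢyᵢ = 0` and `∑ xᵢyᵢzᵢ = 0` on `A`; hence with `P := A * A` (pointwise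
  products) we get `A ⟂ A`, `A ⟂ P` and `𝟙 ⟂ P` for the dot product.
* Restrict to the support of `A` (coordinates where some element of `A` is non-zero).
* Kneser: `2 dim A ≤ dim P + dim St`, `St` the stabiliser algebra of `P`.
* `St` is small: indices are grouped by their evaluation profile on `St`; `St` embeds into the
  functions on the set of profiles, and every profile class has `≥ 3` elements (a non-zero vector
  with `∑ u² = ∑ u³ = 0` has at least three non-zero entries), so `3 dim St ≤ |ι|`.
* Orthogonality: `A ≤ (A ⊔ P)ᗮ` for the (nondegenerate) dot product, so `dim A + dim P ≤ |ι|`.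
* Arithmetic: `9 dim A ≤ 4 |ι|`.
-/

set_option linter.dupNamespace false

noncomputable section

open scoped BigOperators

namespace Summit.ValiantsHypothesis.ValiantsHypothesis.Theorems.RefutationDegreeBeyondHessianSos

/-- A vector `u : ι → ℂ` with `∑ uᵢ² = 0`, `∑ uᵢ³ = 0` and some non-zero coordinate has at least
three non-zero coordinates: every finset containing the support of `u` has `≥ 3` elements. -/
private theorem three_le_card_of_powerSums {ι : Type} [Fintype ι] (u : ι → ℂ)
    (h2 : ∑ i, u i ^ 2 = 0) (h3 : ∑ i, u i ^ 3 = 0) {i₀ : ι} (hi₀ : u i₀ ≠ 0)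
    (s : Finset ι) (hs : ∀ i, u i ≠ 0 → i ∈ s) : 3 ≤ s.card := by
  classical
  have hsum : ∀ k : ℕ, k ≠ 0 → ∑ i ∈ s, u i ^ k = ∑ i, u i ^ k := fun k hk =>
    Finset.sum_subset (Finset.subset_univ s) fun i _ hi => by
      have hu : u i = 0 := by
        by_contra hu
        exact hi (hs i hu)
      simp [hu, hk]
  have e2 := (hsum 2 two_ne_zero).trans h2
  have e3 := (hsum 3 three_ne_zero).trans h3
  have hi₀s : i₀ ∈ s := hs i₀ hi₀
  by_contra hlt
  obtain h | h | h : s.card = 0 ∨ s.card = 1 ∨ s.card = 2 := by omega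
  · rw [Finset.card_eq_zero] at h
    simp [h] at hi₀s
  · obtain ⟨a, rfl⟩ := Finset.card_eq_one.1 h
    rw [Finset.mem_singleton] at hi₀s
    subst hi₀s
    rw [Finset.sum_singleton] at e2
    exact hi₀ ((pow_eq_zero_iff two_ne_zero).1 e2)
  · obtain ⟨a, b, hab, rfl⟩ := Finset.card_eq_two.1 h
    rw [Finset.sum_pair hab] at e2 e3
    have key : u a * u b * (u a + u b) = 0 := by
      linear_combination (u a + u b) * e2 - e3
    have hab0 : u a = 0 ∧ u b = 0 := by
      rcases mul_eq_zero.1 key with h' | h'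
      · rcases mul_eq_zero.1 h' with ha | hb
        · rw [ha] at e2
          exact ⟨ha, by simpa using e2⟩
        · rw [hb] at e2
          exact ⟨by simpa using e2, hb⟩
      · have hb : u b = -u a := by linear_combination h'
        rw [hb] at e2
        have ha : u a ^ 2 = 0 := by linear_combination e2 / 2
        have ha' : u a = 0 := (pow_eq_zero_iff two_ne_zero).1 ha
        exact ⟨ha', by rw [hb, ha', neg_zero]⟩
    rw [Finset.mem_insert, Finset.mem_singleton] at hi₀s
    rcases hi₀s with rfl | rfl
    · exact hi₀ hab0.1
    · exact hi₀ hab0.2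

/-- The full-support case of `stub_cubicNullBound`: if every coordinate is non-zero on some
element of `A`, Kneser's inequality for `A * A` (hypothesis `hKA`) together with `p₂ ≡ p₃ ≡ 0`
on `A` gives `9 · dim A ≤ 4 · |ι|`. -/
private theorem cubicNullBound_of_fullSupport {ι : Type} [Fintype ι] [DecidableEq ι]
    (A : Submodule ℂ (ι → ℂ))
    (hKA : ∃ H : Submodule ℂ (ι → ℂ), (∀ x ∈ H, ∀ v ∈ A * A, x * v ∈ A * A) ∧
        Module.finrank ℂ A + Module.finrank ℂ A ≤
          Module.finrank ℂ ↥(A * A) + Module.finrank ℂ H)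
    (h2 : ∀ x ∈ A, ∑ i, x i ^ 2 = 0) (h3 : ∀ x ∈ A, ∑ i, x i ^ 3 = 0)
    (hfull : ∀ i, ∃ x ∈ A, x i ≠ 0) :
    9 * Module.finrank ℂ A ≤ 4 * Fintype.card ι := by
  classical
  -- (0) polarisation of `p₂` and `p₃`
  have hB : ∀ x ∈ A, ∀ y ∈ A, ∑ i, x i * y i = 0 := by
    intro x hx y hy
    have e : ∑ i, (x + y) i ^ 2 = ∑ i, x i ^ 2 + ∑ i, y i ^ 2 + 2 * ∑ i, x i * y i := by
      rw [Finset.mul_sum, ← Finset.sum_add_distrib, ← Finset.sum_add_distrib]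
      exact Finset.sum_congr rfl fun i _ => by simp only [Pi.add_apply]; ring
    rw [h2 _ (A.add_mem hx hy), h2 x hx, h2 y hy] at e
    linear_combination -e / 2
  have hC : ∀ x ∈ A, ∀ y ∈ A, ∑ i, x i * y i ^ 2 = 0 := by
    intro x hx y hy
    have e : ∑ i, (x + y) i ^ 3 + ∑ i, (x - y) i ^ 3 =
        2 * ∑ i, x i ^ 3 + 6 * ∑ i, x i * y i ^ 2 := by
      rw [Finset.mul_sum, Finset.mul_sum, ← Finset.sum_add_distrib, ← Finset.sum_add_distrib]
      exact Finset.sum_congr rfl fun i _ => by simp only [Pi.add_apply, Pi.sub_apply]; ring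
    rw [h3 _ (A.add_mem hx hy), h3 _ (A.sub_mem hx hy), h3 x hx] at e
    linear_combination -e / 6
  have hT : ∀ x ∈ A, ∀ y ∈ A, ∀ z ∈ A, ∑ i, x i * y i * z i = 0 := by
    intro x hx y hy z hz
    have e : ∑ i, x i * (y + z) i ^ 2 =
        ∑ i, x i * y i ^ 2 + ∑ i, x i * z i ^ 2 + 2 * ∑ i, x i * y i * z i := by
      rw [Finset.mul_sum, ← Finset.sum_add_distrib, ← Finset.sum_add_distrib]
      exact Finset.sum_congr rfl fun i _ => by simp only [Pi.add_apply]; ring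
    rw [hC x hx _ (A.add_mem hy hz), hC x hx y hy, hC x hx z hz] at e
    linear_combination -e / 2
  -- `𝟙 ⟂ P` and `A ⟂ P` for `P := A * A`
  have hP : ∀ v ∈ A * A, (∑ i, v i = 0) ∧ ∀ z ∈ A, ∑ i, z i * v i = 0 := by
    intro v hv
    refine Submodule.mul_induction_on hv ?_ ?_
    · intro x hx y hy
      refine ⟨by simpa only [Pi.mul_apply] using hB x hx y hy, fun z hz => ?_⟩
      have := hT z hz x hx y hy
      simpa only [Pi.mul_apply, mul_assoc] using this
    · intro v w hv hw
      refine ⟨?_, fun z hz => ?_⟩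
      · simp only [Pi.add_apply, Finset.sum_add_distrib, hv.1, hw.1, add_zero]
      · simp only [Pi.add_apply, mul_add, Finset.sum_add_distrib, hv.2 z hz, hw.2 z hz, add_zero]
  -- (2) Kneser and the stabiliser algebra `St` of `P`
  obtain ⟨St, hSt⟩ : ∃ St : Subalgebra ℂ (ι → ℂ), ∀ x, x ∈ St ↔ ∀ v ∈ A * A, x * v ∈ A * A :=
    ⟨{ carrier := {x | ∀ v ∈ A * A, x * v ∈ A * A}
       mul_mem' := fun {x y} hx hy v hv => by
         rw [mul_assoc]
         exact hx _ (hy v hv)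
       add_mem' := fun {x y} hx hy v hv => by
         rw [add_mul]
         exact (A * A).add_mem (hx v hv) (hy v hv)
       algebraMap_mem' := fun c v hv => by
         rw [Algebra.algebraMap_eq_smul_one, smul_mul_assoc, one_mul]
         exact (A * A).smul_mem c hv }, fun _ => Iff.rfl⟩
  obtain ⟨H, hHst, hHdim⟩ := hKA
  have hHle : H ≤ Subalgebra.toSubmodule St := fun x hx =>
    (Subalgebra.mem_toSubmodule St).2 ((hSt x).2 (hHst x hx))
  have hdimH : Module.finrank ℂ H ≤ Module.finrank ℂ St := by
    have := Submodule.finrank_mono hHle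
    rwa [Subalgebra.finrank_toSubmodule] at this
  -- (3) the stabiliser is small: evaluation profiles
  obtain ⟨ev, hev⟩ : ∃ ev : ι → St → ℂ, ∀ i f, ev i f = (f : ι → ℂ) i := ⟨_, fun _ _ => rfl⟩
  obtain ⟨T, hT⟩ : ∃ T : Finset (St → ℂ), T = Finset.univ.image ev := ⟨_, rfl⟩
  have hTmem : ∀ φ, φ ∈ T ↔ ∃ i, ev i = φ := fun φ => by simp [hT]
  have hStle : Module.finrank ℂ St ≤ T.card := by
    let G : St →ₗ[ℂ] (T → ℂ) :=
      { toFun := fun f φ => φ.1 f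
        map_add' := fun f g => funext fun φ => by
          obtain ⟨i, hi⟩ := (hTmem _).1 φ.2
          show φ.1 (f + g) = φ.1 f + φ.1 g
          rw [← hi]
          simp only [hev]
          rfl
        map_smul' := fun c f => funext fun φ => by
          obtain ⟨i, hi⟩ := (hTmem _).1 φ.2
          show φ.1 (c • f) = c * φ.1 f
          rw [← hi]
          simp only [hev]
          rfl }
    have hG : Function.Injective G := by
      intro f g hfg
      apply Subtype.ext
      funext i
      have := congrFun hfg ⟨ev i, (hTmem _).2 ⟨i, rfl⟩⟩
      change ev i f = ev i g at this
      rwa [hev, hev] at this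
    calc Module.finrank ℂ St
        ≤ Module.finrank ℂ (T → ℂ) := LinearMap.finrank_le_finrank_of_injective hG
      _ = T.card := by rw [Module.finrank_fintype_fun_eq_card, Fintype.card_coe]
  -- every profile class has at least three elements
  have hclass : ∀ (i₀ : ι) (C : Finset ι), (∀ i, ev i = ev i₀ → i ∈ C) → 3 ≤ C.card := by
    intro i₀ C hCmem
    have hsep : ∀ j, ∃ f : St, j ∉ C → (f : ι → ℂ) j ≠ (f : ι → ℂ) i₀ := by
      intro j
      by_cases hj : j ∈ C
      · exact ⟨0, fun h => (h hj).elim⟩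
      · have hne : ev j ≠ ev i₀ := fun h => hj (hCmem j h)
        obtain ⟨f, hf⟩ := Function.ne_iff.1 hne
        rw [hev, hev] at hf
        exact ⟨f, fun _ => hf⟩
    choose f hf using hsep
    obtain ⟨g, hg⟩ : ∃ g : ι → ℂ,
        g = ∏ j ∈ Cᶜ, ((f j : ι → ℂ) - algebraMap ℂ (ι → ℂ) ((f j : ι → ℂ) j)) := ⟨_, rfl⟩
    have hgSt : g ∈ St := by
      rw [hg]
      exact St.prod_mem fun j _ => St.sub_mem (f j).2 (St.algebraMap_mem _)
    have hg_apply : ∀ i, g i = ∏ j ∈ Cᶜ, ((f j : ι → ℂ) i - (f j : ι → ℂ) j) := by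
      intro i
      rw [hg, Finset.prod_apply]
      refine Finset.prod_congr rfl fun j _ => ?_
      simp [Algebra.algebraMap_eq_smul_one]
    have hgi₀ : g i₀ ≠ 0 := by
      rw [hg_apply]
      exact Finset.prod_ne_zero_iff.2 fun j hj =>
        sub_ne_zero.2 (hf j (Finset.mem_compl.1 hj)).symm
    have hgC : ∀ i, g i ≠ 0 → i ∈ C := by
      intro i hi
      by_contra hiC
      refine hi ?_
      rw [hg_apply]
      exact Finset.prod_eq_zero (Finset.mem_compl.2 hiC) (sub_self _)
    obtain ⟨x, hxA, hxi₀⟩ := hfull i₀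
    have hxx : x * x ∈ A * A := Submodule.mul_mem_mul hxA hxA
    have hm2 : g * g * (x * x) ∈ A * A := (hSt _).1 (St.mul_mem hgSt hgSt) _ hxx
    have hm3 : g * g * g * (x * x) ∈ A * A :=
      (hSt _).1 (St.mul_mem (St.mul_mem hgSt hgSt) hgSt) _ hxx
    have hu2 : ∑ i, (g i * x i) ^ 2 = 0 := by
      refine Eq.trans (Finset.sum_congr rfl fun i _ => ?_) (hP _ hm2).1
      simp only [Pi.mul_apply]
      ring
    have hu3 : ∑ i, (g i * x i) ^ 3 = 0 := by
      refine Eq.trans (Finset.sum_congr rfl fun i _ => ?_) ((hP _ hm3).2 x hxA)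
      simp only [Pi.mul_apply]
      ring
    exact three_le_card_of_powerSums (fun i => g i * x i) hu2 hu3 (mul_ne_zero hgi₀ hxi₀) C
      fun i hi => hgC i (left_ne_zero_of_mul hi)
  have hT3 : 3 * T.card ≤ Fintype.card ι := by
    have hcard := Finset.card_eq_sum_card_image ev Finset.univ
    rw [Finset.card_univ, ← hT] at hcard
    rw [hcard]
    calc 3 * T.card = ∑ _φ ∈ T, 3 := by
          rw [Finset.sum_const, smul_eq_mul, mul_comm]
      _ ≤ ∑ φ ∈ T, (Finset.univ.filter fun i => ev i = φ).card :=
          Finset.sum_le_sum fun φ hφ => by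
            obtain ⟨i₀, rfl⟩ := (hTmem φ).1 hφ
            exact hclass i₀ _ fun i hi => Finset.mem_filter.2 ⟨Finset.mem_univ i, hi⟩
  -- (4) orthogonality count for the dot product
  have horth : Module.finrank ℂ A + Module.finrank ℂ ↥(A * A) ≤ Fintype.card ι := by
    let B : LinearMap.BilinForm ℂ (ι → ℂ) := dotProductBilin ℂ ℂ
    have hBnd : B.Nondegenerate := by
      refine And.intro (fun x hx => ?_) (fun y hy => ?_)
      · funext i
        have := hx (Pi.single i 1)
        change x ⬝ᵥ Pi.single i 1 = 0 at this
        simpa using this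
      · funext i
        have := hy (Pi.single i 1)
        change Pi.single i 1 ⬝ᵥ y = 0 at this
        simpa using this
    have hAW : A ≤ B.orthogonal (A ⊔ A * A) := by
      intro a ha
      rw [LinearMap.BilinForm.mem_orthogonal_iff]
      intro w hw
      obtain ⟨y, hy, v, hv, rfl⟩ := Submodule.mem_sup.1 hw
      change (y + v) ⬝ᵥ a = 0
      rw [add_dotProduct, dotProduct_comm v a]
      change ∑ i, y i * a i + ∑ i, a i * v i = 0
      rw [hB y hy a ha, (hP v hv).2 a ha, add_zero]
    have hfA := Submodule.finrank_mono hAW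
    have hfO := LinearMap.BilinForm.finrank_orthogonal hBnd (A ⊔ A * A)
    have hfP : Module.finrank ℂ ↥(A * A) ≤ Module.finrank ℂ ↥(A ⊔ A * A) :=
      Submodule.finrank_mono le_sup_right
    have hfW := Submodule.finrank_le (A ⊔ A * A)
    rw [Module.finrank_fintype_fun_eq_card] at hfO hfW
    omega
  -- (5) arithmetic
  omega

/-- **Stub `stub_cubicNullBound`.**  Let `A ⊆ ℂ^ι` be a linear subspace on which the power sums
`p₂(x) = ∑ᵢ xᵢ²` and `p₃(x) = ∑ᵢ xᵢ³` vanish identically.  Assuming Kneser's theorem for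
coordinatewise products of subspaces (`hK`: for all `S, T` there is `H` stabilising `S * T` with
`dim S + dim T ≤ dim (S * T) + dim H`), we have `9 · dim A ≤ 4 · |ι|`.

The proof restricts to the support of `A` and applies `cubicNullBound_of_fullSupport`. -/
theorem stub_cubicNullBound
    (hK : ∀ {ι : Type} [Fintype ι] [DecidableEq ι] (S T : Submodule ℂ (ι → ℂ)),
      ∃ H : Submodule ℂ (ι → ℂ), (∀ x ∈ H, ∀ v ∈ S * T, x * v ∈ S * T) ∧
        Module.finrank ℂ S + Module.finrank ℂ T ≤
          Module.finrank ℂ ↥(S * T) + Module.finrank ℂ H)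
    {ι : Type} [Fintype ι] [DecidableEq ι] (A : Submodule ℂ (ι → ℂ))
    (h2 : ∀ x ∈ A, ∑ i, x i ^ 2 = 0) (h3 : ∀ x ∈ A, ∑ i, x i ^ 3 = 0) :
    9 * Module.finrank ℂ A ≤ 4 * Fintype.card ι := by
  classical
  -- the support of `A`
  let s : Finset ι := Finset.univ.filter fun i => ∃ x ∈ A, x i ≠ 0
  have hs : ∀ x ∈ A, ∀ i, i ∉ s → x i = 0 := by
    intro x hx i hi
    by_contra h
    exact hi (Finset.mem_filter.2 ⟨Finset.mem_univ _, x, hx, h⟩)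
  -- restriction to the support
  obtain ⟨r, hr⟩ : ∃ r : (ι → ℂ) →ₗ[ℂ] (s → ℂ), ∀ x i, r x i = x i :=
    ⟨LinearMap.funLeft ℂ ℂ ((↑) : s → ι), fun _ _ => rfl⟩
  have hsum : ∀ x ∈ A, ∀ k : ℕ, k ≠ 0 → ∑ i : s, x i ^ k = ∑ i, x i ^ k := by
    intro x hx k hk
    have h1 : ∑ i : s, x i ^ k = ∑ i ∈ s, x i ^ k := Finset.sum_coe_sort s (fun i => x i ^ k)
    rw [h1]
    exact Finset.sum_subset (Finset.subset_univ s) fun i _ hi => by simp [hs x hx i hi, hk]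
  have h2' : ∀ x' ∈ A.map r, ∑ i, x' i ^ 2 = 0 := by
    intro x' hx'
    obtain ⟨x, hx, rfl⟩ := Submodule.mem_map.1 hx'
    simp only [hr]
    rw [hsum x hx 2 two_ne_zero]
    exact h2 x hx
  have h3' : ∀ x' ∈ A.map r, ∑ i, x' i ^ 3 = 0 := by
    intro x' hx'
    obtain ⟨x, hx, rfl⟩ := Submodule.mem_map.1 hx'
    simp only [hr]
    rw [hsum x hx 3 three_ne_zero]
    exact h3 x hx
  have hfull : ∀ i : s, ∃ x' ∈ A.map r, x' i ≠ 0 := by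
    intro i
    obtain ⟨x, hx, hxi⟩ := (Finset.mem_filter.1 i.2).2
    exact ⟨r x, Submodule.mem_map_of_mem hx, by rw [hr]; exact hxi⟩
  have hinj : Function.Injective (r.domRestrict A) := by
    rintro ⟨x, hx⟩ ⟨y, hy⟩ hxy
    apply Subtype.ext
    funext i
    by_cases hi : i ∈ s
    · simpa [hr] using congrFun hxy ⟨i, hi⟩
    · simp [hs x hx i hi, hs y hy i hi]
  have hrank : Module.finrank ℂ ↥(A.map r) = Module.finrank ℂ A := by
    rw [← LinearMap.finrank_range_of_inj hinj, LinearMap.range_domRestrict]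
  have hmain := cubicNullBound_of_fullSupport (A.map r) (hK _ _) h2' h3' hfull
  rw [hrank, Fintype.card_coe] at hmain
  exact hmain.trans (Nat.mul_le_mul_left 4 (Finset.card_le_univ s))

end Summit.ValiantsHypothesis.ValiantsHypothesis.Theorems.RefutationDegreeBeyondHessianSos

end
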